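import Summits.ResolutionOfSingularities.ResolutionOfSingularities.Theorems.EquisingularLiftEquisingularLiftNatBlowupStalkPrescribedChart
import Literature.AlgebraicGeometry.Resolution.BlowupsFlatBaseChange
import Literature.AlgebraicGeometry.Resolution.BlowupAlgebraPresentation
import HarnessLib

/-!
# [OURS · L1 W4.5(b) · EL♮(3)] T-PTPRIME-DICT (3/3): in a fixed chart the POINT of a blowing up is determined by the prime;
# the vertex point of a frame is unique; off the vertex a non-vertex member of the frame generates the exceptional stalk

Crux chain w45b (cell `res-hironaka`, slot W4.5(b)), working crux **EL♮** = stmt-ResolutionOfSingularities-20038, child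
**EL♮(3)** = stmt-ResolutionOfSingularities-20148, route EquisingularLift, line `sections`, registered stub
`stub_elnat_tcPlusPointResolution`; assembly HSUB(ReachTC⁺)₃ (driver `hsub_reachTCPlus_of_invariant` p526242, INV DEFS v3
p532383), brick `inv_base`, sub-brick **B5** = Member clause (v) OFF THE CONE POINT for the CENTRED member (res-type-100's
decomposition 2026-08-27T13:39:56Z; dealt to res-L1-w45b-stub-2 by res-L1-w45b-plan-1 RULING 14:38:30Z (R-A)). HONEST FRAMING:
OURS; NOT a statement of any manuscript; Stacks 0804/0805 bookkeeping; AI-written, weaker than expert review. No `sorry`;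
standard axioms. DEF-FREE. `--supports stmt-ResolutionOfSingularities-20148 --as helper`.

WHY. Clause (v) of the centred member must be proved at every special point `z ≠ j₂ y` of the Δ-centre, and the proof goes
through a chart `c_l`, `l ≠ 0`, of the frame adapted to `y` (`y = [1:0:0]`, T-FRAME-AT p527425): so one needs «`z ≠` the vertex
point ⇒ some `c_l`, `l ≠ 0`, generates the exceptional stalk at `z`», i.e. the VERTEX POINT IS UNIQUE, i.e. (Stacks 0804) the
map «prime of the chart algebra `𝒪_{X,s}[J_s/c_j]` over `𝔪_s` ↦ point of `π⁻¹ s`» is INJECTIVE — the converse of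
`chartPrime_eq_of_presentations` (T-PTPRIME-DICT 1/2, p521370) which says it is well defined.

WHAT (namespace `…Cruxes.EquisingularLiftNat.Sections`; ANY blowing up `π : X' → X` along `J`, no Noetherian / integrality
hypotheses):
* `eq_of_stalkIso_of_isBlowup` — two points `z₁, z₂` of `X'` over the same point of `X` whose local rings are isomorphic
  COMPATIBLY WITH `π♯` coincide. Proof: the two morphisms `Spec 𝒪_{X',z₁} → X'` (the canonical one, and the canonical one of `z₂`
  after the isomorphism) agree after `π` (Mathlib `Scheme.SpecMap_stalkMap_fromSpecStalk`), and the common composite pulls the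
  centre back to an effective Cartier divisor (`Spec 𝒪_{X',z₁} → X'` is flat, tree `flat_fromSpecStalk` +
  `IsEffectiveCartier.comap_of_flat`), so they are equal by the uniqueness half of the universal property (`IsBlowup.hom_ext`);
  evaluate at the closed point.
* `eq_of_chartPresentation_of_prime_eq` — **in a fixed chart the point is determined by the prime**: two points over `s`
  presented on the same chart `c_j` at the SAME prime `𝔔` coincide (both local rings are the localisation of the chart algebra at
  `𝔔`, `IsLocalization.algEquiv`).
* `exists_chartPresentation_of_eq` — the tree's presentation `IsBlowup.exists_blowupAlgebra_stalk_ringEquiv` for generators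
  given at a point `s = π x'` (the `stalkCongr` currency of res-type-100 / res-D-pv-029's B1★ / B3).
* `eval_mem_iff_of_forall_frac_mem`, `chartPrime_eq_of_forall_frac_mem` — a prime `𝔔` of `𝒪_{X,s}[J_s/c_j]` over `𝔪_s`
  containing every fraction `c_l/c_j`, `l ≠ j`, is determined (`h(c/c_j) ∈ 𝔔 ↔ h(0) ∈ 𝔪_s`): the VERTEX prime of the chart.
* `eq_of_vertex` — **the vertex point is unique**: two points over `s` presented on the chart `c_j` with all `c_l/c_j ∈ 𝔔`
  (`l ≠ j`) coincide; `frac_mem_chartPrime_iff` reads the condition as `χ(c_l/c_j) ∈ 𝔪_{z}`.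
* `exists_generator_ne_of_ne_vertex` — **off the vertex a non-vertex member of the frame generates the exceptional stalk**:
  if `z ≠ z₀` lie over `s` and `z₀` is the vertex point of the chart `c_j`, then `(J·𝒪_{X'})_z = (π♯ c_l)` for some `l ≠ j`.

References: The Stacks Project, Tags 0804, 0805; tree `BlowupStalkCharts.lean`, `BlowupStalkBlowupAlgebra.lean`,
`BlowupAlgebraPresentation.lean`; p521370 (…NatBlowupChartPointOfPrime), B1★ p537631 (…NatBlowupStalkPrescribedChart).
-/

set_option linter.dupNamespace false -- mandated namespace `Summit.<Summit>.<Problem>` of this single-conjunct summit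

noncomputable section

open CategoryTheory CategoryTheory.Limits AlgebraicGeometry TopologicalSpace IsLocalRing
open Literature.AlgebraicGeometry.Resolution
open AlgebraicGeometry.Scheme.IdealSheafData

namespace Summit.ResolutionOfSingularities.ResolutionOfSingularities.Cruxes.EquisingularLiftNat.Sections

universe u

variable {X' X : Scheme.{u}} {π : X' ⟶ X} {J : X.IdealSheafData}

/-! ## 1. Points with `π`-compatibly isomorphic local rings coincide -/

/-- **Two points of a blowing up over the same point of the base whose local rings are isomorphic compatibly with `π♯`
coincide.** `π : X' → X` a blowing up along `J`, `π z₁ = s = π z₂`, `e : 𝒪_{X',z₂} ≅ 𝒪_{X',z₁}` with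
`e ∘ π♯_{z₂} = π♯_{z₁}` on `𝒪_{X,s}`. The morphisms `Spec 𝒪_{X',z₁} → X'` at `z₁` and (through `e`) at `z₂` agree after `π`,
and the common composite pulls `V(J)` back to an effective Cartier divisor (flatness of `Spec 𝒪_{X',z₁} → X'`), so they
agree (`IsBlowup.hom_ext`); evaluate at the closed point. [cite: StacksProject, Tag 0804; GortzWedhorn2020, Def. 13.90] -/
theorem eq_of_stalkIso_of_isBlowup (hπ : IsBlowup π J) {z₁ z₂ : X'} {s : X} (h₁ : π z₁ = s) (h₂ : π z₂ = s)
    (e : X'.presheaf.stalk z₂ ≅ X'.presheaf.stalk z₁)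
    (he : (X.presheaf.stalkCongr (.of_eq h₂)).inv ≫ π.stalkMap z₂ ≫ e.hom =
      (X.presheaf.stalkCongr (.of_eq h₁)).inv ≫ π.stalkMap z₁) : z₁ = z₂ := by
  subst h₁
  -- the two morphisms `Spec 𝒪_{X',z₁} → X'`
  have hcomp : X'.fromSpecStalk z₁ ≫ π = (Spec.map e.hom ≫ X'.fromSpecStalk z₂) ≫ π := by
    have h1 : (X.presheaf.stalkCongr (.of_eq (rfl : π z₁ = π z₁))).inv = 𝟙 _ := by
      rw [TopCat.Presheaf.stalkCongr_inv]
      exact TopCat.Presheaf.stalkSpecializes_refl X.presheaf (π z₁)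
    rw [h1, Category.id_comp] at he
    rw [← Scheme.SpecMap_stalkMap_fromSpecStalk, ← he, Spec.map_comp, Spec.map_comp, Category.assoc, Category.assoc,
      TopCat.Presheaf.stalkCongr_inv, Scheme.SpecMap_stalkSpecializes_fromSpecStalk, Scheme.SpecMap_stalkMap_fromSpecStalk,
      Category.assoc]
  have hW : IsEffectiveCartier (J.comap (X'.fromSpecStalk z₁ ≫ π)) := by
    rw [Scheme.IdealSheafData.comap_comp]
    haveI := flat_fromSpecStalk X' z₁
    exact hπ.isEffectiveCartier.comap_of_flat _
  have hg := hπ.hom_ext hW hcomp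
  haveI : IsLocalHom e.hom.hom := by
    have h := isLocalHom_equiv e.commRingCatIsoToRingEquiv
    exact ⟨fun a ha => h.1 a ha⟩
  calc z₁ = X'.fromSpecStalk z₁ (closedPoint (X'.presheaf.stalk z₁)) := Scheme.fromSpecStalk_closedPoint.symm
    _ = (Spec.map e.hom ≫ X'.fromSpecStalk z₂) (closedPoint (X'.presheaf.stalk z₁)) := by rw [hg]
    _ = X'.fromSpecStalk z₂ (Spec.map e.hom (closedPoint (X'.presheaf.stalk z₁))) := by rw [Scheme.Hom.comp_apply]
    _ = X'.fromSpecStalk z₂ (closedPoint (X'.presheaf.stalk z₂)) := by rw [Spec_closedPoint]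
    _ = z₂ := Scheme.fromSpecStalk_closedPoint

/-! ## 2. In a fixed chart the point is determined by the prime -/

/-- **In a fixed chart the point is determined by the prime** (Stacks 0804: the chart `Spec 𝒪_{X,s}[J_s/c_j]` of the blowing up
maps injectively to `X'`). Let `z₁, z₂ ∈ X'` lie over `s`, `c` a family in `𝒪_{X,s}` (e.g. generators of `J_s`), and `(𝔔, χ₁)`,
`(𝔔, χ₂)` presentations of `𝒪_{X',z₁}`, `𝒪_{X',z₂}` as localisations of the chart algebra `𝒪_{X,s}[J_s/c_j]` at the SAME prime `𝔔`,
with `χᵢ` extending `π♯_{zᵢ}`. Then `z₁ = z₂`. [cite: StacksProject, Tag 0804] -/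
theorem eq_of_chartPresentation_of_prime_eq (hπ : IsBlowup π J) {z₁ z₂ : X'} {s : X} (h₁ : π z₁ = s) (h₂ : π z₂ = s)
    {k : ℕ} (c : Fin k → X.presheaf.stalk s) (j : Fin k)
    (𝔔 : PrimeSpectrum (blowupAlgebra (Ideal.span (Set.range c)) (c j)))
    (χ₁ : blowupAlgebra (Ideal.span (Set.range c)) (c j) →+* X'.presheaf.stalk z₁)
    (χ₂ : blowupAlgebra (Ideal.span (Set.range c)) (c j) →+* X'.presheaf.stalk z₂)
    (hχ₁ : ∀ a, χ₁ (algebraMap _ _ a) = ((X.presheaf.stalkCongr (.of_eq h₁)).inv ≫ π.stalkMap z₁).hom a)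
    (hχ₂ : ∀ a, χ₂ (algebraMap _ _ a) = ((X.presheaf.stalkCongr (.of_eq h₂)).inv ≫ π.stalkMap z₂).hom a)
    (hloc₁ : @IsLocalization.AtPrime _ _ (X'.presheaf.stalk z₁) _ χ₁.toAlgebra 𝔔.asIdeal _)
    (hloc₂ : @IsLocalization.AtPrime _ _ (X'.presheaf.stalk z₂) _ χ₂.toAlgebra 𝔔.asIdeal _) : z₁ = z₂ := by
  letI alg₁ := χ₁.toAlgebra
  letI alg₂ := χ₂.toAlgebra
  haveI : IsLocalization.AtPrime (X'.presheaf.stalk z₁) 𝔔.asIdeal := hloc₁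
  haveI : IsLocalization.AtPrime (X'.presheaf.stalk z₂) 𝔔.asIdeal := hloc₂
  -- both local rings are THE localisation of the chart algebra at `𝔔`
  let e₀ : X'.presheaf.stalk z₂ ≃ₐ[blowupAlgebra (Ideal.span (Set.range c)) (c j)] X'.presheaf.stalk z₁ :=
    IsLocalization.algEquiv 𝔔.asIdeal.primeCompl _ _
  have he₀ : ∀ b, e₀ (χ₂ b) = χ₁ b := fun b => e₀.commutes b
  refine eq_of_stalkIso_of_isBlowup hπ h₁ h₂ e₀.toRingEquiv.toCommRingCatIso ?_
  ext a
  change e₀ (((X.presheaf.stalkCongr (.of_eq h₂)).inv ≫ π.stalkMap z₂).hom a) =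
    ((X.presheaf.stalkCongr (.of_eq h₁)).inv ≫ π.stalkMap z₁).hom a
  rw [← hχ₂, he₀, hχ₁]

/-- The tree's chart presentation of the local ring of a point of a blowing up (`IsBlowup.exists_blowupAlgebra_stalk_ringEquiv`),
for generators `c` of `J_s` given AT `s = π x'` (read through `𝒪_{X,s} ≅ 𝒪_{X,π x'}`). [cite: StacksProject, Tag 0804] -/
theorem exists_chartPresentation_of_eq (hπ : IsBlowup π J) (x' : X') {s : X} (hx : π x' = s) {k : ℕ}
    (c : Fin k → X.presheaf.stalk s) (hc : Ideal.span (Set.range c) = stalkIdeal J s) :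
    ∃ (j : Fin k) (𝔔 : PrimeSpectrum (blowupAlgebra (Ideal.span (Set.range c)) (c j)))
      (χ : blowupAlgebra (Ideal.span (Set.range c)) (c j) →+* X'.presheaf.stalk x'),
      (∀ a, χ (algebraMap _ _ a) = ((X.presheaf.stalkCongr (.of_eq hx)).inv ≫ π.stalkMap x').hom a) ∧
      @IsLocalization.AtPrime _ _ (X'.presheaf.stalk x') _ χ.toAlgebra 𝔔.asIdeal _ ∧
      𝔔.asIdeal.comap (algebraMap _ (blowupAlgebra (Ideal.span (Set.range c)) (c j))) = maximalIdeal (X.presheaf.stalk s) := by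
  subst hx
  obtain ⟨j, 𝔔, χ, -, hχ, hloc, -, h𝔔⟩ := hπ.exists_blowupAlgebra_stalk_ringEquiv x' c hc
  refine ⟨j, 𝔔, χ, fun a => ?_, hloc, h𝔔⟩
  rw [hχ a, CommRingCat.comp_apply, TopCat.Presheaf.stalkCongr_inv]
  congr 1
  exact (stalkSpecializes_self_apply X.presheaf (π x') _ a).symm

/-! ## 3. The vertex prime of a chart -/

section Vertex

variable {R : Type u} [CommRing R] [IsLocalRing R] {k : ℕ} (c : Fin k → R) (j : Fin k)

/-- **Membership in a vertex prime is read on the constant term.** If a prime (indeed any ideal) `𝔔` of `R[I/c_j]`,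
`I = (c)`, lies over `𝔪_R` and contains every fraction `c_l/c_j`, `l ≠ j`, then for every `h ∈ R[T_l : l ≠ j]`:
`h(c/c_j) ∈ 𝔔 ↔ h(0) ∈ 𝔪_R` (the evaluation and «constant term, then `R → R[I/c_j]`» agree modulo `𝔔` on the generators
`T_l` and on `R`). [cite: StacksProject, Tag 052P] -/
theorem eval_mem_iff_of_forall_frac_mem (𝔔 : Ideal (blowupAlgebra (Ideal.span (Set.range c)) (c j)))
    (h𝔔 : 𝔔.comap (algebraMap R (blowupAlgebra (Ideal.span (Set.range c)) (c j))) = maximalIdeal R)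
    (hfr : ∀ l : Fin k, l ≠ j → blowupAlgebra.frac c j l ∈ 𝔔) (h : MvPolynomial {l : Fin k // l ≠ j} R) :
    blowupAlgebra.eval c j h ∈ 𝔔 ↔ MvPolynomial.constantCoeff h ∈ maximalIdeal R := by
  -- the two ring maps `R[T] → R[I/c_j] ⧸ 𝔔` agree
  have hagree : (Ideal.Quotient.mk 𝔔).comp (blowupAlgebra.eval c j).toRingHom =
      ((Ideal.Quotient.mk 𝔔).comp (algebraMap R (blowupAlgebra (Ideal.span (Set.range c)) (c j)))).comp
        MvPolynomial.constantCoeff := by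
    refine MvPolynomial.ringHom_ext (fun r => ?_) (fun l => ?_)
    · simp only [RingHom.comp_apply, AlgHom.toRingHom_eq_coe, RingHom.coe_coe, blowupAlgebra.eval_C,
        MvPolynomial.constantCoeff_C]
    · simp only [RingHom.comp_apply, AlgHom.toRingHom_eq_coe, RingHom.coe_coe, blowupAlgebra.eval_X,
        MvPolynomial.constantCoeff_X, map_zero]
      exact Ideal.Quotient.eq_zero_iff_mem.mpr (hfr l.1 l.2)
  have hh := RingHom.congr_fun hagree h
  simp only [RingHom.comp_apply, AlgHom.toRingHom_eq_coe, RingHom.coe_coe] at hh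
  rw [← Ideal.Quotient.eq_zero_iff_mem, hh, Ideal.Quotient.eq_zero_iff_mem, ← Ideal.mem_comap, h𝔔]

/-- **The vertex prime of a chart is unique**: two ideals of `R[I/c_j]` over `𝔪_R` containing every `c_l/c_j`, `l ≠ j`, are
equal (every element of the chart algebra is some `h(c/c_j)`, tree `blowupAlgebra.eval_surjective`). [cite: StacksProject, Tag 052P] -/
theorem chartPrime_eq_of_forall_frac_mem (𝔔₁ 𝔔₂ : Ideal (blowupAlgebra (Ideal.span (Set.range c)) (c j)))
    (h𝔔₁ : 𝔔₁.comap (algebraMap R (blowupAlgebra (Ideal.span (Set.range c)) (c j))) = maximalIdeal R)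
    (h𝔔₂ : 𝔔₂.comap (algebraMap R (blowupAlgebra (Ideal.span (Set.range c)) (c j))) = maximalIdeal R)
    (hfr₁ : ∀ l : Fin k, l ≠ j → blowupAlgebra.frac c j l ∈ 𝔔₁)
    (hfr₂ : ∀ l : Fin k, l ≠ j → blowupAlgebra.frac c j l ∈ 𝔔₂) : 𝔔₁ = 𝔔₂ := by
  ext b
  obtain ⟨h, rfl⟩ := blowupAlgebra.eval_surjective c j b
  rw [eval_mem_iff_of_forall_frac_mem c j 𝔔₁ h𝔔₁ hfr₁, eval_mem_iff_of_forall_frac_mem c j 𝔔₂ h𝔔₂ hfr₂]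

end Vertex

/-- For a presentation `(𝔔, χ)` of `𝒪_{X',z}` as a localisation of the chart algebra: `b ∈ 𝔔 ↔ χ b ∈ 𝔪_z` (Mathlib
`IsLocalization.AtPrime.to_map_mem_maximal_iff`, restated for the `χ.toAlgebra` structure). [folklore] -/
theorem mem_chartPrime_iff_apply_mem_maximalIdeal {B S : Type u} [CommRing B] [CommRing S] [IsLocalRing S]
    (𝔔 : PrimeSpectrum B) (χ : B →+* S) (hloc : @IsLocalization.AtPrime _ _ S _ χ.toAlgebra 𝔔.asIdeal _) (b : B) :
    b ∈ 𝔔.asIdeal ↔ χ b ∈ maximalIdeal S := by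
  letI := χ.toAlgebra
  haveI : IsLocalization.AtPrime S 𝔔.asIdeal := hloc
  exact (IsLocalization.AtPrime.to_map_mem_maximal_iff S 𝔔.asIdeal b).symm

/-- **The vertex point is unique.** Two points `z₁, z₂` of the blowing up over `s`, each presented on the chart `c_j` at a prime
over `𝔪_s` containing all the fractions `c_l/c_j`, `l ≠ j` (i.e. `χᵢ(c_l/c_j) ∈ 𝔪_{zᵢ}`: both are «the point `[0:…:1:…:0]` of the
fibre»), coincide. [cite: StacksProject, Tag 0804] -/
theorem eq_of_vertex (hπ : IsBlowup π J) {z₁ z₂ : X'} {s : X} (h₁ : π z₁ = s) (h₂ : π z₂ = s)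
    {k : ℕ} (c : Fin k → X.presheaf.stalk s) (j : Fin k)
    (𝔔₁ 𝔔₂ : PrimeSpectrum (blowupAlgebra (Ideal.span (Set.range c)) (c j)))
    (χ₁ : blowupAlgebra (Ideal.span (Set.range c)) (c j) →+* X'.presheaf.stalk z₁)
    (χ₂ : blowupAlgebra (Ideal.span (Set.range c)) (c j) →+* X'.presheaf.stalk z₂)
    (hχ₁ : ∀ a, χ₁ (algebraMap _ _ a) = ((X.presheaf.stalkCongr (.of_eq h₁)).inv ≫ π.stalkMap z₁).hom a)
    (hχ₂ : ∀ a, χ₂ (algebraMap _ _ a) = ((X.presheaf.stalkCongr (.of_eq h₂)).inv ≫ π.stalkMap z₂).hom a)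
    (hloc₁ : @IsLocalization.AtPrime _ _ (X'.presheaf.stalk z₁) _ χ₁.toAlgebra 𝔔₁.asIdeal _)
    (hloc₂ : @IsLocalization.AtPrime _ _ (X'.presheaf.stalk z₂) _ χ₂.toAlgebra 𝔔₂.asIdeal _)
    (h𝔔₁ : 𝔔₁.asIdeal.comap (algebraMap _ (blowupAlgebra (Ideal.span (Set.range c)) (c j))) =
      maximalIdeal (X.presheaf.stalk s))
    (h𝔔₂ : 𝔔₂.asIdeal.comap (algebraMap _ (blowupAlgebra (Ideal.span (Set.range c)) (c j))) =
      maximalIdeal (X.presheaf.stalk s))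
    (hfr₁ : ∀ l : Fin k, l ≠ j → blowupAlgebra.frac c j l ∈ 𝔔₁.asIdeal)
    (hfr₂ : ∀ l : Fin k, l ≠ j → blowupAlgebra.frac c j l ∈ 𝔔₂.asIdeal) : z₁ = z₂ := by
  have h𝔔 : 𝔔₁ = 𝔔₂ :=
    PrimeSpectrum.ext (chartPrime_eq_of_forall_frac_mem c j 𝔔₁.asIdeal 𝔔₂.asIdeal h𝔔₁ h𝔔₂ hfr₁ hfr₂)
  subst h𝔔
  exact eq_of_chartPresentation_of_prime_eq hπ h₁ h₂ c j 𝔔₁ χ₁ χ₂ hχ₁ hχ₂ hloc₁ hloc₂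

/-! ## 4. Off the vertex, a non-vertex member of the frame generates the exceptional stalk -/

/-- For a presentation `(𝔔, χ)` of `𝒪_{X',z}` on the chart `c_j` (`c` generators of `J_s`, `π z = s`): the exceptional stalk
`(J·𝒪_{X'})_z` is generated by `π♯(c_j)`. [cite: StacksProject, Tag 0804] -/
theorem stalkIdeal_comap_eq_span_of_chartPresentation (z : X') {s : X} (hz : π z = s) {k : ℕ}
    (c : Fin k → X.presheaf.stalk s) (hc : Ideal.span (Set.range c) = stalkIdeal J s) (j : Fin k)
    (χ : blowupAlgebra (Ideal.span (Set.range c)) (c j) →+* X'.presheaf.stalk z)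
    (hχ : ∀ a, χ (algebraMap _ _ a) = ((X.presheaf.stalkCongr (.of_eq hz)).inv ≫ π.stalkMap z).hom a) :
    stalkIdeal (J.comap π) z = Ideal.span {((X.presheaf.stalkCongr (.of_eq hz)).inv ≫ π.stalkMap z).hom (c j)} := by
  subst hz
  have hχ' : ∀ a, χ (algebraMap _ _ a) = (π.stalkMap z).hom a := fun a => by
    rw [hχ a, CommRingCat.comp_apply, TopCat.Presheaf.stalkCongr_inv]
    congr 1
    exact stalkSpecializes_self_apply X.presheaf (π z) _ a
  have hstalkMap : (π.stalkMap z).hom = χ.comp (algebraMap _ (blowupAlgebra (Ideal.span (Set.range c)) (c j))) :=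
    RingHom.ext fun a => (hχ' a).symm
  rw [← hχ (c j), hχ' (c j), stalkIdeal_comap_eq_map_stalkMap, ← hc, hstalkMap, ← Ideal.map_map,
    map_blowupAlgebra_eq_span (Ideal.subset_span (Set.mem_range_self j)), Ideal.map_span, Set.image_singleton]
  rfl

/-- If `π♯(c_j)` generates the exceptional stalk at `z` and `χ(c_l/c_j)` is a unit of `𝒪_{X',z}` (for a chart-`c_j` presentation
`χ`), then `π♯(c_l)` generates it too (`π♯(c_l) = χ(c_l/c_j) · π♯(c_j)`). [folklore] -/
theorem stalkIdeal_comap_eq_span_of_isUnit_frac (z : X') {s : X} (hz : π z = s) {k : ℕ}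
    (c : Fin k → X.presheaf.stalk s) (j l : Fin k)
    (χ : blowupAlgebra (Ideal.span (Set.range c)) (c j) →+* X'.presheaf.stalk z)
    (hχ : ∀ a, χ (algebraMap _ _ a) = ((X.presheaf.stalkCongr (.of_eq hz)).inv ≫ π.stalkMap z).hom a)
    (hE : stalkIdeal (J.comap π) z = Ideal.span {((X.presheaf.stalkCongr (.of_eq hz)).inv ≫ π.stalkMap z).hom (c j)})
    (hu : IsUnit (χ (blowupAlgebra.frac c j l))) :
    stalkIdeal (J.comap π) z = Ideal.span {((X.presheaf.stalkCongr (.of_eq hz)).inv ≫ π.stalkMap z).hom (c l)} := by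
  have hmul := apply_frac_mul c j l χ ((X.presheaf.stalkCongr (.of_eq hz)).inv ≫ π.stalkMap z).hom hχ
  rw [hE, ← hmul]
  exact (Ideal.span_singleton_mul_left_unit hu _).symm

/-- **Off the vertex, a non-vertex member of the frame generates the exceptional stalk.** Let `π : X' → X` be a blowing up
along `J`, `c` generators of `J_s`, `j` a chart index, and `z₀ ∈ X'` over `s` THE VERTEX POINT of the chart `c_j` (presented on
the chart `c_j` at a prime containing all `c_l/c_j`, `l ≠ j`). Then at every other point `z ≠ z₀` over `s` the exceptional stalk
`(J·𝒪_{X'})_z` is generated by `π♯(c_l)` for some `l ≠ j`. (Present `z` on some chart `c_i`; if `i ≠ j` take `l = i`; if `i = j`,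
either some `c_l/c_j` is a unit at `z` — then `π♯(c_l)` generates — or all of them lie in `𝔪_z`, and then `z` is a vertex point, so
`z = z₀` by `eq_of_vertex`.) [cite: StacksProject, Tag 0804] -/
theorem exists_generator_ne_of_ne_vertex (hπ : IsBlowup π J) {z₀ z : X'} {s : X} (h₀ : π z₀ = s) (hz : π z = s)
    {k : ℕ} (c : Fin k → X.presheaf.stalk s) (hc : Ideal.span (Set.range c) = stalkIdeal J s) (j : Fin k)
    (𝔔₀ : PrimeSpectrum (blowupAlgebra (Ideal.span (Set.range c)) (c j)))
    (χ₀ : blowupAlgebra (Ideal.span (Set.range c)) (c j) →+* X'.presheaf.stalk z₀)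
    (hχ₀ : ∀ a, χ₀ (algebraMap _ _ a) = ((X.presheaf.stalkCongr (.of_eq h₀)).inv ≫ π.stalkMap z₀).hom a)
    (hloc₀ : @IsLocalization.AtPrime _ _ (X'.presheaf.stalk z₀) _ χ₀.toAlgebra 𝔔₀.asIdeal _)
    (h𝔔₀ : 𝔔₀.asIdeal.comap (algebraMap _ (blowupAlgebra (Ideal.span (Set.range c)) (c j))) =
      maximalIdeal (X.presheaf.stalk s))
    (hfr₀ : ∀ l : Fin k, l ≠ j → blowupAlgebra.frac c j l ∈ 𝔔₀.asIdeal) (hne : z ≠ z₀) :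
    ∃ l : Fin k, l ≠ j ∧
      stalkIdeal (J.comap π) z = Ideal.span {((X.presheaf.stalkCongr (.of_eq hz)).inv ≫ π.stalkMap z).hom (c l)} := by
  classical
  obtain ⟨i, 𝔔, χ, hχ, hloc, h𝔔⟩ := exists_chartPresentation_of_eq hπ z hz c hc
  have hEi := stalkIdeal_comap_eq_span_of_chartPresentation z hz c hc i χ hχ
  by_cases hij : i = j
  · subst hij
    by_cases hall : ∀ l : Fin k, l ≠ i → blowupAlgebra.frac c i l ∈ 𝔔.asIdeal
    · exact absurd (eq_of_vertex hπ hz h₀ c i 𝔔 𝔔₀ χ χ₀ hχ hχ₀ hloc hloc₀ h𝔔 h𝔔₀ hall hfr₀) hne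
    · push Not at hall
      obtain ⟨l, hl, hl𝔔⟩ := hall
      refine ⟨l, hl, stalkIdeal_comap_eq_span_of_isUnit_frac z hz c i l χ hχ hEi ?_⟩
      have h := mt (mem_chartPrime_iff_apply_mem_maximalIdeal 𝔔 χ hloc (blowupAlgebra.frac c i l)).mpr hl𝔔
      rwa [mem_maximalIdeal, mem_nonunits_iff, not_not] at h
  · exact ⟨i, hij, hEi⟩

end Summit.ResolutionOfSingularities.ResolutionOfSingularities.Cruxes.EquisingularLiftNat.Sections

end
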